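import Summits.CriticalPhenomena.PercolationContinuityZ3.Theorems.SahiMasterFamilyPhiVertexSharp

/-!
# The absorption factor in CLOSED FORM, every order: `Φ_K(h) = Σ_{σ∈S_m} ∏_{c∈cyc σ} (K − E ∏_{i∈c} h_i)`;
# hence `Φ_{k+1}(cap β) = Σ_{σ∈S_k} ∏_{c∈cyc σ} (1 − β_c)`, the vanishing of `Φ` with TWO free indices, and the
# counting form of the sharp vertex inequality `#{τ ∈ Sym(T∖t₀) : no cycle in 𝒰} ≤ Σ_{σ : cycles ∈ 𝒰} (−1)^{#cyc−1}`

Unit `prim-masterthm-p4` (gen 17; crux anchor stmt-CriticalPhenomena-4575, helper work; memo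
`run/shared/lean/prim/prim-masterthm/prim-masterthm-p4/P4-GEN17-REPORT.md` §2).  Companion of `…SahiJoinAbsorption` (seat l12-p5:
the absorption factor `absorbFactor`, DEFINED by the insertion recursion, its closed form stated in the docstring but not proved),
`…PrincipalCapStep` (gen 13's abstract step), `…PhiVertexSharp` (gen 17: `0 ≤ Φ(cap β) ≤ Φ(β)`).

**THEOREM `absorbFactor_eq_sum_perm` (every `m`, every weight, every `K`).**
`absorbFactor μ K m h = Σ_{σ : Perm (Fin m)} ∏_{B ∈ orbits σ} (K − E_μ ∏_{i∈B} h_i)` — induction along Lieb–Sahi's "drop `0` from its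
cycle" decomposition `decomposeFin` [LiebSahi2021, proof of Prop. 3.3], exactly as in the tree's `sahiECycle_succ_succ`
(`CycleForm.orbits_decomposeFin_zero/succ`, `prod_liftBlock`).

**COROLLARIES (every order).**
* `phiSet_cap_eq_sum_perm`: for `β univ = 1`, `Φ_{k+1}(cap β) = Σ_{σ ∈ S_k} ∏_{c ∈ cyc σ} (1 − β_{c})` (`cap β` = `1` on the sets
  containing the last index; the cycles `c ⊆ [k]` are read in `Fin (k+1)` through `castSucc`).  In the defect variables `d = 1 − β` this
  is the permutation partition function `W_{[k]}(d) = Σ_σ ∏_c d_c` of gen 16's report §11–§12, so gen 17's sharp step reads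
  `Φ_T(β) = W_{T∖t}(d) + Σ_{t∈B⊊T} (|B|−1)!·d_B·Φ_{T∖B}(β|_{T∖B})` (memo §2).
* `phiSet_eq_zero_of_two_free`: if `β_B = 1` for every `B` containing the last index and for every `B` containing a second index
  `a ≠ last`, then `Φ_{k+1}(β) = 0` (every permutation of `[k]` has a cycle through `a`) — the faces `Z_{ab}` of the vertex census
  (`run/shared/lean/ttrl/vconj/VCONJ.md`: "Psi vanishes identically on Z_ab"), for ALL real `β`, not only `0/1` points.
* `phiSet_indicator_capFamily_eq_card`: for any family `𝒰 ∋ univ`, `Φ_{k+1}(1_{𝒰 ∪ ⟨last⟩}) = #{τ ∈ S_k : no cycle support of τ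
  (read in `Fin (k+1)`) lies in `𝒰}`; with `PhiVertexSharp.phiSet_indicator_capFamily_le` this is gen 16's (V♯) in its counting form
  `card_derangedPerm_le_phiSet_indicator`: **`N_𝒰(T∖last) ≤ Φ_T(1_𝒰) = Σ_i N_𝒰(T∖i) − N_𝒰(T)`** for every union-closed `𝒰 ∋ T`.
HONEST FRAMING: identities and the vertex case; `(UC-hull)_k` / `F^UC(k)` (k ≥ 8), Sahi's `C_k`, Kahn's Conjecture 5 and the master
theorem remain OPEN.  Axioms standard. [this work]
-/

noncomputable section

open scoped Classical

namespace Summit.CriticalPhenomena.PercolationContinuityZ3.Theorems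

namespace PhiCapClosedForm

open Finset Function Equiv
open Literature.Combinatorics.Sahi2008
open Literature.Combinatorics.Sahi2008.CycleForm
open PrincipalCapBeta (phiSet realF realW)
open PrincipalCapStep (ex_fTop fTop_mul_realF ex_prod_realF_castSucc)
open SahiJoinAbsorption (absorbFactor absorbFactor_zero absorbFactor_succ)

variable {α : Type*} [Fintype α]

/-! ### Two small facts about `liftBlock` (the tree's versions are file-private) -/

/-- `(liftBlock e B).erase 0 = succ(B)`. [folklore] -/
theorem liftBlock_erase_zero {n : ℕ} (e : Fin n) (B : Finset (Fin n)) :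
    (liftBlock e B).erase 0 = B.map (Fin.succEmb n) := by
  have h0 : (0 : Fin (n + 1)) ∉ B.map (Fin.succEmb n) := by
    simp only [mem_map, Fin.coe_succEmb, not_exists, not_and]
    exact fun j _ => Fin.succ_ne_zero j
  unfold liftBlock
  split_ifs
  · rw [erase_insert h0]
  · rw [erase_eq_of_notMem h0]

/-- `liftBlock e` is injective. [folklore] -/
theorem liftBlock_injective {n : ℕ} (e : Fin n) : Function.Injective (liftBlock e) := by
  intro B B' h
  have h1 := liftBlock_erase_zero e B
  rw [h, liftBlock_erase_zero] at h1
  exact (map_injective (Fin.succEmb n)) h1.symm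

/-- Shifted blocks are not the singleton `{0}`. [folklore] -/
theorem map_succ_ne_singleton_zero {n : ℕ} (B : Finset (Fin n)) (hB : B.Nonempty) :
    B.map (Fin.succEmb n) ≠ ({0} : Finset (Fin (n + 1))) := by
  intro h
  obtain ⟨j, hj⟩ := hB
  have : (Fin.succEmb n j) ∈ ({0} : Finset (Fin (n + 1))) := h ▸ mem_map_of_mem _ hj
  rw [mem_singleton, Fin.coe_succEmb] at this
  exact Fin.succ_ne_zero j this

/-- Cycles are nonempty. [folklore] -/
theorem nonempty_of_mem_orbits {κ : Type*} [Fintype κ] [DecidableEq κ] {σ : Perm κ} {B : Finset κ}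
    (hB : B ∈ orbits σ) : B.Nonempty := by
  obtain ⟨i, _, rfl⟩ := mem_image.1 hB
  exact ⟨i, self_mem_orbit σ i⟩

/-! ### The closed form of the absorption factor -/

/-- **CLOSED FORM OF THE ABSORPTION FACTOR (every `m`, every weight `μ`, every `K`).**
`absorbFactor μ K m h = Σ_{σ ∈ S_m} ∏_{c ∈ cyc σ} (K − E_μ(∏_{i∈c} h_i))`: the insertion recursion defining `absorbFactor` is the
recursion of this cycle sum under "drop `0` from its cycle" [LiebSahi2021, proof of Prop. 3.3]. [this work] -/
theorem absorbFactor_eq_sum_perm (μ : α → ℝ) (K : ℝ) : ∀ (m : ℕ) (h : Fin m → α → ℝ),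
    absorbFactor μ K m h =
      ∑ σ : Perm (Fin m), ∏ B ∈ orbits σ, (K - ex μ (fun x => ∏ i ∈ B, h i x))
  | 0, h => by
    rw [absorbFactor_zero, Fintype.sum_unique]
    have : orbits (default : Perm (Fin 0)) = ∅ := by
      unfold orbits
      rw [Finset.univ_eq_empty, image_empty]
    rw [this, prod_empty]
  | m + 1, h => by
    rw [absorbFactor_succ, ← Equiv.sum_comp Equiv.Perm.decomposeFin.symm, Fintype.sum_prod_type, Fin.sum_univ_succ]
    congr 1
    · -- `σ(0) = 0`: the fixed point `0` contributes the factor `K − E h_0`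
      rw [absorbFactor_eq_sum_perm μ K m (Fin.tail h), mul_sum]
      refine sum_congr rfl fun τ _ => ?_
      have hnot : ({0} : Finset (Fin (m + 1))) ∉ (orbits τ).image (fun B => B.map (Fin.succEmb m)) := by
        rw [mem_image]
        rintro ⟨B, hB, hB0⟩
        exact map_succ_ne_singleton_zero B (nonempty_of_mem_orbits hB) hB0
      rw [orbits_decomposeFin_zero, prod_insert hnot, prod_image fun B _ B' _ hBB' => map_injective _ hBB']
      congr 1
      · congr 1
        congr 1
        funext x
        rw [prod_singleton]
      · refine prod_congr rfl fun B _ => ?_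
        congr 1
        congr 1
        funext x
        rw [prod_map]
        rfl
    · -- `σ(0) = e.succ`: `0` inserted into the cycle through `e`, slot `e` absorbs `h_0`
      refine sum_congr rfl fun e _ => ?_
      rw [absorbFactor_eq_sum_perm μ K m _]
      refine sum_congr rfl fun τ _ => ?_
      rw [orbits_decomposeFin_succ, prod_image fun B _ B' _ hBB' => liftBlock_injective e hBB']
      refine prod_congr rfl fun B _ => ?_
      congr 1
      congr 1
      funext x
      exact (prod_liftBlock h e B x).symm

/-- The nonnegativity of the closed form for `K = 1` under moment bounds, re-derived from the closed form: each factor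
`1 − E ∏_{i∈c} h_i ≥ 0`. (Gen 13's `absorbFactor_one_nonneg_of_moments` proved this along the recursion.) [this work] -/
theorem sum_perm_prod_nonneg_of_moments (μ : α → ℝ) (m : ℕ) (h : Fin m → α → ℝ)
    (hmom : ∀ S : Finset (Fin m), S.Nonempty → ex μ (∏ i ∈ S, h i) ≤ 1) :
    0 ≤ ∑ σ : Perm (Fin m), ∏ B ∈ orbits σ, (1 - ex μ (fun x => ∏ i ∈ B, h i x)) := by
  refine sum_nonneg fun σ _ => prod_nonneg fun B hB => sub_nonneg.2 ?_
  have e1 : (fun x => ∏ i ∈ B, h i x) = ∏ i ∈ B, h i := funext fun x => (Finset.prod_apply x B h).symm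
  rw [e1]
  exact hmom B (nonempty_of_mem_orbits hB)

/-! ### `Φ_{k+1}(cap β)` in closed form -/

variable {k : ℕ}

/-- **`Φ_{k+1}(cap β) = Σ_{σ ∈ S_k} ∏_{c ∈ cyc σ} (1 − β_c)`** for `β univ = 1`, where `cap β = (B ↦ 1 if last ∈ B, β_B otherwise)`
and a cycle `c ⊆ Fin k` is read in `Fin (k+1)` through `castSucc`.  In defect variables `d = 1 − β`: `Φ(cap β) = W_{[k]}(d)`, the
permutation partition function `Σ_σ ∏_c d_c`. [this work] -/
theorem phiSet_cap_eq_sum_perm (β : Finset (Fin (k + 1)) → ℝ) (huniv : β univ = 1) :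
    phiSet (k + 1) (fun B => if Fin.last k ∈ B then 1 else β B) =
      ∑ σ : Perm (Fin k), ∏ B ∈ orbits σ, (1 - β (B.map Fin.castSuccEmb)) := by
  rw [PhiVertexSharp.phiSet_cap_eq_sahiE β huniv,
    SahiJoinAbsorption.sahiE_snoc_eq_of_absorbing (realW β) (fun j : Fin k => realF j.castSucc)
      (∏ i : Fin (k + 1), realF i) fTop_mul_realF,
    ex_fTop, huniv, mul_one, absorbFactor_eq_sum_perm]
  refine sum_congr rfl fun σ _ => prod_congr rfl fun B _ => ?_
  congr 1
  have e1 : (fun x => ∏ i ∈ B, (fun j : Fin k => realF j.castSucc) i x) =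
      ∏ i ∈ B, (fun j : Fin k => (realF j.castSucc : Finset (Fin (k + 1)) → ℝ)) i :=
    funext fun x => (Finset.prod_apply x B _).symm
  rw [e1, ex_prod_realF_castSucc]

/-- **Two free indices kill `Φ`** (the faces `Z_{ab}`), for every real set function: if `β_B = 1` whenever `last ∈ B` and whenever
`a ∈ B` (`a ≠ last`), then `Φ_{k+1}(β) = 0` — every permutation of `Fin k` has a cycle through `a`, whose factor `1 − β` vanishes.
[this work] -/
theorem phiSet_eq_zero_of_two_free (β : Finset (Fin (k + 1)) → ℝ) (hlast : ∀ B, Fin.last k ∈ B → β B = 1)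
    (a : Fin k) (ha : ∀ B, Fin.castSucc a ∈ B → β B = 1) : phiSet (k + 1) β = 0 := by
  have hcap : (fun B => if Fin.last k ∈ B then 1 else β B) = β := by
    funext B
    by_cases h : Fin.last k ∈ B
    · rw [if_pos h, hlast B h]
    · rw [if_neg h]
  rw [← hcap, phiSet_cap_eq_sum_perm β (hlast univ (mem_univ _))]
  refine sum_eq_zero fun σ _ => prod_eq_zero (orbit_mem_orbits σ a) ?_
  rw [ha _ (mem_map.2 ⟨a, self_mem_orbit σ a, rfl⟩), sub_self]

/-- The same with the two free indices in either order of generality: `β_B = 1` whenever `B` meets `{a, b}`, `a ≠ b`, forces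
`Φ_{k+1}(β) = 0` (relabel `b ↦ last` by `PhiCert.phiSet_actV`). [this work] -/
theorem phiSet_eq_zero_of_two_free' (β : Finset (Fin (k + 1)) → ℝ) {a b : Fin (k + 1)} (hab : a ≠ b)
    (ha : ∀ B, a ∈ B → β B = 1) (hb : ∀ B, b ∈ B → β B = 1) : phiSet (k + 1) β = 0 := by
  set σ : Perm (Fin (k + 1)) := Equiv.swap b (Fin.last k) with hσ
  rw [← PhiCert.phiSet_actV σ β]
  have hσb : σ (Fin.last k) = b := by rw [hσ, swap_apply_right]
  have hσa : σ (σ a) = a := by rw [hσ, swap_apply_self]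
  have hne : σ a ≠ Fin.last k := by
    intro h
    apply hab
    have := congrArg σ h
    rwa [hσa, hσb] at this
  obtain ⟨a', ha'⟩ := Fin.exists_castSucc_eq.2 hne
  refine phiSet_eq_zero_of_two_free (PhiCert.actV σ β) (fun B hB => ?_) a' (fun B hB => ?_)
  · unfold PhiCert.actV
    exact hb _ (mem_map.2 ⟨Fin.last k, hB, hσb⟩)
  · unfold PhiCert.actV
    refine ha _ (mem_map.2 ⟨Fin.castSucc a', hB, ?_⟩)
    show σ (Fin.castSucc a') = a
    rw [ha', hσa]

/-! ### The counting form of the sharp vertex inequality -/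

/-- **`Φ_{k+1}(1_{𝒰 ∪ ⟨last⟩})` counts the permutations of `[k]` with NO cycle support in `𝒰`** (any family `𝒰 ∋ univ`):
`Φ_{k+1}(1_{𝒰 ∪ ⟨last⟩}) = #{τ ∈ S_k : ∀ c ∈ cyc τ, castSucc(c) ∉ 𝒰}` = `N_𝒰([k+1] ∖ last)` of gen 16's report §12. [this work] -/
theorem phiSet_indicator_capFamily_eq_card (𝒰 : Finset (Finset (Fin (k + 1)))) (htop : univ ∈ 𝒰) :
    phiSet (k + 1) (fun S => if S ∈ 𝒰 ∨ Fin.last k ∈ S then (1 : ℝ) else 0) =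
      (((univ : Finset (Perm (Fin k))).filter
        (fun τ => ∀ B ∈ orbits τ, B.map Fin.castSuccEmb ∉ 𝒰)).card : ℝ) := by
  have hcap : (fun S : Finset (Fin (k + 1)) => if S ∈ 𝒰 ∨ Fin.last k ∈ S then (1 : ℝ) else 0) =
      fun S => if Fin.last k ∈ S then 1 else (if S ∈ 𝒰 then (1 : ℝ) else 0) := by
    funext S
    by_cases h1 : Fin.last k ∈ S <;> by_cases h2 : S ∈ 𝒰 <;> simp [h1, h2]
  rw [hcap, phiSet_cap_eq_sum_perm _ (if_pos htop), Finset.card_eq_sum_ones, Nat.cast_sum, sum_filter]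
  refine sum_congr rfl fun τ _ => ?_
  by_cases hτ : ∀ B ∈ orbits τ, B.map Fin.castSuccEmb ∉ 𝒰
  · rw [if_pos hτ, Nat.cast_one]
    exact prod_eq_one fun B hB => by rw [if_neg (hτ B hB), sub_zero]
  · rw [if_neg hτ]
    push Not at hτ
    obtain ⟨B, hB, hBU⟩ := hτ
    exact prod_eq_zero hB (by rw [if_pos hBU, sub_self])

/-- **(V♯), counting form, every order.**  For every union-closed family `𝒰 ∋ univ` of subsets of `Fin (k+1)`:
`#{τ ∈ S_k : no cycle support of τ (read through castSucc) lies in 𝒰} ≤ Φ_{k+1}(1_𝒰)`; since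
`Φ_{k+1}(1_𝒰) = Σ_i N_𝒰(T∖i) − N_𝒰(T)` (defect form) this is gen 16's `k·N(T) ≤ (k−1)·Σ_i N(T∖i)` after symmetrisation. [this work] -/
theorem card_derangedPerm_le_phiSet_indicator (𝒰 : Finset (Finset (Fin (k + 1))))
    (hU : ∀ A ∈ 𝒰, ∀ B ∈ 𝒰, A ∪ B ∈ 𝒰) (htop : univ ∈ 𝒰) :
    (((univ : Finset (Perm (Fin k))).filter
        (fun τ => ∀ B ∈ orbits τ, B.map Fin.castSuccEmb ∉ 𝒰)).card : ℝ) ≤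
      phiSet (k + 1) (fun S => if S ∈ 𝒰 then 1 else 0) := by
  rw [← phiSet_indicator_capFamily_eq_card 𝒰 htop]
  exact PhiVertexSharp.phiSet_indicator_capFamily_le 𝒰 hU htop

/-- … and in pure cycle language: `#{τ ∈ S_k : no cycle of τ in 𝒰} ≤ Σ_{σ ∈ S_{k+1} : all cycles ∈ 𝒰} (−1)^{#cyc(σ)−1}`. [this work] -/
theorem card_derangedPerm_le_sum_perm_sign (𝒰 : Finset (Finset (Fin (k + 1))))
    (hU : ∀ A ∈ 𝒰, ∀ B ∈ 𝒰, A ∪ B ∈ 𝒰) (htop : univ ∈ 𝒰) :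
    (((univ : Finset (Perm (Fin k))).filter
        (fun τ => ∀ B ∈ orbits τ, B.map Fin.castSuccEmb ∉ 𝒰)).card : ℝ) ≤
      ∑ σ ∈ (univ : Finset (Perm (Fin (k + 1)))).filter (fun σ => ∀ B ∈ orbits σ, B ∈ 𝒰),
        (-1 : ℝ) ^ ((orbits σ).card - 1) := by
  rw [← PhiVertexSharp.phiSet_indicator_eq_sum_perm (fun S => S ∈ 𝒰)]
  exact card_derangedPerm_le_phiSet_indicator 𝒰 hU htop

end PhiCapClosedForm

end Summit.CriticalPhenomena.PercolationContinuityZ3.Theorems
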